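import Summits.QuantumFields.YangMills.Theorems.FluctuationComparisonRegPrIntLS2BetaFacePreimageIdentity
import Summits.QuantumFields.YangMills.Theorems.FluctuationComparisonRegPrIntLS2BetaSignedCombKill
import HarnessLib

/-!
# S2β ∕ GAP♯∘ strata residue, (RINV-curl) brick (B5a) — THE OUTGOING FACE LAYER OF A `k`-BLOCK: residue coordinates, the layer ∕ edge COUNTS
# `#layer ≤ N^{d−1}`, `#edge ≤ N^{d−2}` (`N = L^k`), and the face-bond ∕ layer logic (generic `P : Params`; DEFINITION-FREE)

Cell `ym3-torus` (YM ladder rung R3 = continuum `SU(2)` Yang–Mills on the three-torus — a RUNG: NOT d = 4, NOT infinite volume,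
NOT a mass gap, NOT Clay).  Width seat «width 16» `ym3-torus-px16` (gen 22), FREE px helper on crux `stmt-QuantumFields-20520`
(`FluctuationComparisonRegPrIntL`), count-neutral, DEFINITION-FREE (0 `def`, 0 `instance`, 0 `notation`, 0 `sorry`), default heartbeats.

WHY.  The face-preimage road to (RINV-curl) (door ✓`…S2BetaPreimagesOfFaceSpreads.exists_preimage_curl_of_faceSpreads`, identity (B3′)
✓`…S2BetaFacePreimageIdentity`) needs input (iii), the FACE CURL COUNT `Σ_p ‖(curl_{U₀} X^{+μ}_B w)_p‖ ≤ C‖w‖` with `C = O(N)` at `d = 3`: the face spread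
`X^{+μ}_B w` lives on the `N^{d−1}` bonds `⟨z, μ⟩` of the OUTGOING `μ`-LAYER of the block `B^k(x)` (`z ∈ B^k(x)`, `z + e_μ ∈ B^k(x + e_μ)`), its covariant curl
lives on the `(μ, κ)`-plaquettes meeting that layer: `2(d−1)·N^{d−2}` PERIMETER plaquettes (one face bond; cost `‖w‖` each) and `≤ (d−1)·N^{d−1}` IN-LAYER
plaquettes (two face bonds; cost `2(θ₀ + δ_I)‖w‖` each, one plaquette and one interior comb cycle).  THIS FILE supplies the lattice half: the COUNTS and the
face ∕ layer LOGIC; the curl estimate itself is ✓∕⧗`…S2BetaFaceSpreadCurlCount`.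
WHAT (standing range `k ≤ m + K`; `k + 1 ≤ m + K` where three blocks per direction are needed).
* §1 RESIDUE COORDINATES: inside one `k`-block a finest site is determined by its residues `(z ν).val % L^k` (`eq_of_blockIter_eq_of_mod_eq`); leaving the block
  by `+e_ν` forces the residue `L^k − 1` (`mod_eq_of_blockIter_shift_ne`), by `−e_ν` the residue `0` (`mod_eq_zero_of_blockIter_unshift_ne`);
  ★`card_le_pow_of_residues` — a set of sites of ONE block whose residues are PRESCRIBED on a set `S` of directions has at most `(L^k)^{d − #S}` elements
  (injection into `(Sᶜ → Fin L^k)`).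
* §2 THE LAYER: ★`card_layer_le` (`#{z ∈ B^k(x) | B^k(z + e_μ) ≠ x} ≤ (L^k)^{d−1}`), ★`card_layer_shift_ne_le` ∕ ★`card_layer_unshift_ne_le` (the two `κ`-edges of
  the layer, `≤ (L^k)^{d−2}` for `κ ≠ μ`).
* §3 FACE ∕ LAYER LOGIC (`k + 1 ≤ m + K`): `face_iff` (a bond runs from `B^k(x)` to `B^k(x + e_μ)` iff it is a `μ`-bond on the layer), `layer_shift` ∕ `not_layer_shift`
  (along `κ ≠ μ` the layer is entered and left only through the block boundary), `card_perimeter_out_le` ∕ `card_perimeter_in_le` (both perimeter types `≤ (L^k)^{d−2}`).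

HONEST SCOPE.  Torus bookkeeping on the tree's own lattice; nothing of Bałaban's analysis is asserted; (B5) (the curl count), (B4b), (D2), (RINV-curl), MULT♮,
AVG₂♭-ax, «CRIT-ax», (D-ax), GAP♯∘ (`stub_uniformFibreGapOrbit`; registry `Lines/semiclassical_s2beta.lean` 3732b7df UNTOUCHED), the five registered stubs, S2β,
crux 20520, 19936, 19200 and `YM3TorusSU2` are NOT proved; no registered stub is closed; the Yang–Mills mass gap is NOT proved.  Sorry-free, axioms standard.

References: T. Bałaban, CMP **109** (1987) 249–301 [Balaban1987RG1] ((0.1)–(0.3) pp.251–252: the blocks `B^k(x)` and their labels); CMP **98** (1985) 17–51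
[Balaban1985Averaging] ((5) p.18: bonds and plaquettes).
-/

set_option autoImplicit false

open Finset Function
open Literature.MathematicalPhysics.QuantumFieldTheory.Balaban1983to89
open Literature.MathematicalPhysics.QuantumFieldTheory.Balaban1983to89.B14.Eq22Determines (blockIter blockIter_zero blockIter_succ)
open Summit.QuantumFields.YangMills.Theorems.FluctuationComparisonRegPrIntLS2BetaSignedCombKill (val_blockIter blockIter_eq_iff sitesPerDir_zero_eq)
open Summit.QuantumFields.YangMills.Theorems.FluctuationComparisonRegPrIntLS2BetaFacePreimageIdentity
  (blockIter_shift_or shift_eq_shift_iff ne_shift_self shift_shift_ne_self blockIter_tgt_or)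

namespace Summit.QuantumFields.YangMills.Theorems.FluctuationComparisonRegPrIntLS2BetaFaceLayerCounts

variable {P : Params} {k : ℕ}

/-! ## §1 Residue coordinates inside a `k`-block -/

/-- Inside one `k`-block a finest site is determined by its residues modulo `L^k` (the quotients are the block label, lit ✓`blockIter_eq_iff`).
[cite: Balaban1987RG1, (0.1) p.251 (bookkeeping)] -/
theorem eq_of_blockIter_eq_of_mod_eq (hk : k ≤ P.m + P.K) {z z' : Site P 0} (hb : blockIter k z = blockIter k z')
    (hm : ∀ ν, (z ν).val % P.L ^ k = (z' ν).val % P.L ^ k) : z = z' := by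
  funext ν
  apply ZMod.val_injective
  have hq := (blockIter_eq_iff hk z z').1 hb ν
  rw [← Nat.div_add_mod (z ν).val (P.L ^ k), ← Nat.div_add_mod (z' ν).val (P.L ^ k), hq, hm ν]

/-- A unit shift changes no other coordinate. [folklore] -/
theorem shift_apply_of_ne (z : Site P 0) {μ ν : Fin P.d} (h : ν ≠ μ) : (z.shift μ) ν = z ν := by
  simp [Site.shift, Function.update_of_ne h]

/-- A unit shift backwards changes no other coordinate. [folklore] -/
theorem unshift_apply_of_ne (z : Site P 0) {μ ν : Fin P.d} (h : ν ≠ μ) : (z.unshift μ) ν = z ν := by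
  simp [Site.unshift, Function.update_of_ne h]

/-- **LEAVING A BLOCK FORWARDS FORCES THE TOP RESIDUE**: if `B^k(z + e_ν) ≠ B^k(z)` then `(z ν).val % L^k = L^k − 1`.
[cite: Balaban1987RG1, (0.1) p.251 (bookkeeping)] -/
theorem mod_eq_of_blockIter_shift_ne (hk : k ≤ P.m + P.K) {z : Site P 0} {ν : Fin P.d} (h : blockIter k (z.shift ν) ≠ blockIter k z) :
    (z ν).val % P.L ^ k = P.L ^ k - 1 := by
  have hN := sitesPerDir_zero_eq (P := P) hk
  have hNpos : 0 < P.L ^ k := pow_pos P.L_pos k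
  by_contra hne
  apply h
  rw [blockIter_eq_iff hk]
  intro ι
  by_cases hι : ι = ν
  · subst hι
    have hs : (z.shift ι) ι = z ι + 1 := by simp [Site.shift]
    rw [hs]
    -- shorthand: `v = N·q + r`, `r ≤ N − 2`
    have hN2 : 2 ≤ P.L ^ k := by
      by_contra hlt
      have h1 : P.L ^ k = 1 := by omega
      rw [h1, Nat.mod_one] at hne
      exact hne rfl
    obtain ⟨q, hq⟩ : ∃ q, (z ι).val / P.L ^ k = q := ⟨_, rfl⟩
    obtain ⟨r, hr⟩ : ∃ r, (z ι).val % P.L ^ k = r := ⟨_, rfl⟩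
    have hdm : P.L ^ k * q + r = (z ι).val := by rw [← hq, ← hr]; exact Nat.div_add_mod _ _
    have hrlt : r < P.L ^ k := hr ▸ Nat.mod_lt _ hNpos
    rw [hr] at hne
    have hmod : ((z ι).val + 1) % P.L ^ k = r + 1 := by
      rw [← hdm, add_assoc, Nat.mul_add_mod, Nat.mod_eq_of_lt (by omega)]
    have hdiv : ((z ι).val + 1) / P.L ^ k = q := by
      rw [← hdm, add_assoc, Nat.mul_add_div hNpos, Nat.div_eq_of_lt (by omega), add_zero]
    -- no wrap-around: `N` is a multiple of `L^k` while `(v + 1) % L^k = r + 1 ≠ 0`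
    have hz : (z ι).val < P.sitesPerDir 0 := ZMod.val_lt _
    have hlt' : (z ι).val + 1 < P.sitesPerDir 0 := by
      by_contra hge
      have hE : (z ι).val + 1 = P.sitesPerDir 0 := by omega
      have h0 : ((z ι).val + 1) % P.L ^ k = 0 := by rw [hE, hN, Nat.mul_mod_right]
      omega
    have hv : (z ι + 1).val = (z ι).val + 1 := by
      rw [ZMod.val_add, ZMod.val_one_eq_one_mod, Nat.add_mod_mod, Nat.mod_eq_of_lt hlt']
    rw [hv, hdiv, hq]
  · rw [shift_apply_of_ne z hι]

/-- **LEAVING A BLOCK BACKWARDS FORCES THE BOTTOM RESIDUE**: if `B^k(z − e_ν) ≠ B^k(z)` then `(z ν).val % L^k = 0`.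
[cite: Balaban1987RG1, (0.1) p.251 (bookkeeping)] -/
theorem mod_eq_zero_of_blockIter_unshift_ne (hk : k ≤ P.m + P.K) {z : Site P 0} {ν : Fin P.d} (h : blockIter k (z.unshift ν) ≠ blockIter k z) :
    (z ν).val % P.L ^ k = 0 := by
  have hNpos : 0 < P.L ^ k := pow_pos P.L_pos k
  by_contra hne
  apply h
  rw [blockIter_eq_iff hk]
  intro ι
  by_cases hι : ι = ν
  · subst hι
    have hs : (z.unshift ι) ι = z ι - 1 := by simp [Site.unshift]
    rw [hs]
    obtain ⟨q, hq⟩ : ∃ q, (z ι).val / P.L ^ k = q := ⟨_, rfl⟩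
    obtain ⟨r, hr⟩ : ∃ r, (z ι).val % P.L ^ k = r := ⟨_, rfl⟩
    have hdm : P.L ^ k * q + r = (z ι).val := by rw [← hq, ← hr]; exact Nat.div_add_mod _ _
    have hrlt : r < P.L ^ k := hr ▸ Nat.mod_lt _ hNpos
    rw [hr] at hne
    have hrpos : 1 ≤ r := Nat.one_le_iff_ne_zero.2 hne
    have hpos : 1 ≤ (z ι).val := by omega
    have hv : (z ι - 1).val = (z ι).val - 1 := by
      have hz : (z ι).val < P.sitesPerDir 0 := ZMod.val_lt _
      have hcast : z ι - 1 = (((z ι).val - 1 : ℕ) : ZMod (P.sitesPerDir 0)) := by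
        rw [Nat.cast_sub hpos, ZMod.natCast_zmod_val, Nat.cast_one]
      rw [hcast, ZMod.val_natCast, Nat.mod_eq_of_lt (by omega)]
    have hdiv : ((z ι).val - 1) / P.L ^ k = q := by
      have heq : (z ι).val - 1 = P.L ^ k * q + (r - 1) := by omega
      rw [heq, Nat.mul_add_div hNpos, Nat.div_eq_of_lt (by omega), add_zero]
    rw [hv, hdiv, hq]
  · rw [unshift_apply_of_ne z hι]

/-- ★ **A SET OF SITES OF ONE `k`-BLOCK WITH PRESCRIBED RESIDUES ON THE DIRECTIONS IN `S` HAS AT MOST `(L^k)^{d − #S}` ELEMENTS** (injection into the residue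
vectors on the remaining directions). [cite: Balaban1987RG1, (0.1)-(0.3) pp.251-252 (bookkeeping)] -/
theorem card_le_pow_of_residues (hk : k ≤ P.m + P.K) (x : Site P k) (S : Finset (Fin P.d)) (r : Fin P.d → ℕ) (A : Finset (Site P 0))
    (hA : ∀ z ∈ A, blockIter k z = x ∧ ∀ ν ∈ S, (z ν).val % P.L ^ k = r ν) :
    A.card ≤ (P.L ^ k) ^ (P.d - S.card) := by
  classical
  have hNpos : 0 < P.L ^ k := pow_pos P.L_pos k
  -- the residue vector on the directions outside `S`
  let φ : Site P 0 → ({ν : Fin P.d // ν ∉ S} → Fin (P.L ^ k)) := fun z ν => ⟨(z ν.1).val % P.L ^ k, Nat.mod_lt _ hNpos⟩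
  have hinj : Set.InjOn φ A := by
    intro z hz z' hz' hφ
    obtain ⟨hb, hr⟩ := hA z hz
    obtain ⟨hb', hr'⟩ := hA z' hz'
    refine eq_of_blockIter_eq_of_mod_eq hk (hb.trans hb'.symm) fun ν => ?_
    by_cases hν : ν ∈ S
    · rw [hr ν hν, hr' ν hν]
    · have := congrFun hφ ⟨ν, hν⟩
      simpa [φ, Fin.ext_iff] using this
  have hcard := Finset.card_le_card_of_injOn φ (fun z _ => Finset.mem_univ (φ z)) hinj
  refine hcard.trans ?_
  rw [Finset.card_univ, Fintype.card_pi, Finset.prod_const, Fintype.card_fin, Finset.card_univ]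
  have hS : Fintype.card {ν : Fin P.d // ν ∉ S} = P.d - S.card := by
    rw [Fintype.card_subtype_compl, Fintype.card_fin, Fintype.card_coe]
  rw [hS]

/-! ## §2 The outgoing `μ`-layer of `B^k(x)` and its two `κ`-edges, counted -/

/-- ★ **THE OUTGOING `μ`-LAYER OF A `k`-BLOCK HAS AT MOST `(L^k)^{d−1}` SITES** (`{z ∈ B^k(x) | B^k(z + e_μ) ≠ x}`; in fact exactly that many).
[cite: Balaban1987RG1, (0.3) p.252 (bookkeeping)] -/
theorem card_layer_le (hk : k ≤ P.m + P.K) (x : Site P k) (μ : Fin P.d) :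
    (univ.filter fun z : Site P 0 => blockIter k z = x ∧ blockIter k (z.shift μ) ≠ x).card ≤ (P.L ^ k) ^ (P.d - 1) := by
  classical
  have h := card_le_pow_of_residues hk x {μ} (fun _ => P.L ^ k - 1)
    (univ.filter fun z : Site P 0 => blockIter k z = x ∧ blockIter k (z.shift μ) ≠ x) fun z hz => by
      rw [mem_filter] at hz
      refine ⟨hz.2.1, fun ν hν => ?_⟩
      rw [mem_singleton] at hν; subst hν
      exact mod_eq_of_blockIter_shift_ne hk (by rw [hz.2.1]; exact hz.2.2)
  rwa [card_singleton] at h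

/-- ★ **THE FORWARD `κ`-EDGE OF THE LAYER** (`κ ≠ μ`): `#{z ∈ layer | B^k(z + e_κ) ≠ x} ≤ (L^k)^{d−2}`. [cite: Balaban1987RG1, (0.3) p.252 (bookkeeping)] -/
theorem card_layer_shift_ne_le (hk : k ≤ P.m + P.K) (x : Site P k) {μ κ : Fin P.d} (hκ : κ ≠ μ) :
    (univ.filter fun z : Site P 0 => blockIter k z = x ∧ blockIter k (z.shift μ) ≠ x ∧ blockIter k (z.shift κ) ≠ x).card ≤ (P.L ^ k) ^ (P.d - 2) := by
  classical
  have h := card_le_pow_of_residues hk x {μ, κ} (fun _ => P.L ^ k - 1)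
    (univ.filter fun z : Site P 0 => blockIter k z = x ∧ blockIter k (z.shift μ) ≠ x ∧ blockIter k (z.shift κ) ≠ x) fun z hz => by
      rw [mem_filter] at hz
      refine ⟨hz.2.1, fun ν hν => ?_⟩
      rw [mem_insert, mem_singleton] at hν
      rcases hν with hν | hν <;> subst hν
      · exact mod_eq_of_blockIter_shift_ne hk (by rw [hz.2.1]; exact hz.2.2.1)
      · exact mod_eq_of_blockIter_shift_ne hk (by rw [hz.2.1]; exact hz.2.2.2)
  rwa [card_pair hκ.symm] at h

/-- ★ **THE BACKWARD `κ`-EDGE OF THE LAYER** (`κ ≠ μ`): `#{z ∈ layer | B^k(z − e_κ) ≠ x} ≤ (L^k)^{d−2}`. [cite: Balaban1987RG1, (0.3) p.252 (bookkeeping)] -/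
theorem card_layer_unshift_ne_le (hk : k ≤ P.m + P.K) (x : Site P k) {μ κ : Fin P.d} (hκ : κ ≠ μ) :
    (univ.filter fun z : Site P 0 => blockIter k z = x ∧ blockIter k (z.shift μ) ≠ x ∧ blockIter k (z.unshift κ) ≠ x).card ≤ (P.L ^ k) ^ (P.d - 2) := by
  classical
  have h := card_le_pow_of_residues hk x {μ, κ} (fun ν => if ν = μ then P.L ^ k - 1 else 0)
    (univ.filter fun z : Site P 0 => blockIter k z = x ∧ blockIter k (z.shift μ) ≠ x ∧ blockIter k (z.unshift κ) ≠ x) fun z hz => by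
      rw [mem_filter] at hz
      refine ⟨hz.2.1, fun ν hν => ?_⟩
      rw [mem_insert, mem_singleton] at hν
      rcases hν with hν | hν <;> subst hν
      · rw [if_pos rfl]; exact mod_eq_of_blockIter_shift_ne hk (by rw [hz.2.1]; exact hz.2.2.1)
      · rw [if_neg hκ]; exact mod_eq_zero_of_blockIter_unshift_ne hk (by rw [hz.2.1]; exact hz.2.2.2)
  rwa [card_pair hκ.symm] at h

/-! ## §3 Face bonds and the layer (three blocks per direction: `k + 1 ≤ m + K`) -/

/-- **A BOND RUNS FROM `B^k(x)` TO `B^k(x + e_μ)` IFF IT IS A `μ`-BOND ON THE OUTGOING `μ`-LAYER OF `B^k(x)`.** [cite: Balaban1987RG1, (0.3) p.252 (bookkeeping)] -/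
theorem face_iff (hk : k ≤ P.m + P.K) (x : Site P k) (μ : Fin P.d) (b : PBond P 0) :
    (blockIter k b.src = x ∧ blockIter k b.tgt = x.shift μ) ↔ (b.dir = μ ∧ blockIter k b.src = x ∧ blockIter k (b.src.shift μ) ≠ x) := by
  constructor
  · rintro ⟨hs, ht⟩
    have hdir : b.dir = μ := by
      rcases blockIter_tgt_or hk b with h | h
      · exact absurd (hs.symm.trans (h.symm.trans ht)) (ne_shift_self x μ)
      · rw [ht, hs, shift_eq_shift_iff] at h; exact h.symm
    refine ⟨hdir, hs, ?_⟩
    have : b.tgt = b.src.shift μ := by rw [← hdir]; rfl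
    rw [← this, ht]; exact (ne_shift_self x μ).symm
  · rintro ⟨hdir, hs, hne⟩
    refine ⟨hs, ?_⟩
    have : b.tgt = b.src.shift μ := by rw [← hdir]; rfl
    rw [this]
    rcases blockIter_shift_or k hk b.src μ with h | h
    · exact absurd (h.trans hs) hne
    · rw [h, hs]

/-- On the layer, `B^k(z + e_μ) = x + e_μ` (the only other possibility). [cite: Balaban1987RG1, (0.3) p.252 (bookkeeping)] -/
theorem blockIter_shift_eq_of_layer (hk : k ≤ P.m + P.K) {x : Site P k} {μ : Fin P.d} {z : Site P 0} (hz : blockIter k z = x)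
    (hne : blockIter k (z.shift μ) ≠ x) : blockIter k (z.shift μ) = x.shift μ := by
  rcases blockIter_shift_or k hk z μ with h | h
  · exact absurd (h.trans hz) hne
  · rw [h, hz]

/-- **ALONG `κ` THE LAYER IS LEFT ONLY THROUGH THE BLOCK BOUNDARY**: if `z` is on the layer then `B^k(z + e_κ + e_μ) ≠ x` (so `z + e_κ` is on the layer as soon
as it is still in `B^k(x)`; `k + 1 ≤ m + K`: two shifts never return to `x`). [cite: Balaban1987RG1, (0.3) p.252 (bookkeeping)] -/
theorem layer_shift (hk : k + 1 ≤ P.m + P.K) {x : Site P k} {μ : Fin P.d} (κ : Fin P.d) {z : Site P 0} (hz : blockIter k z = x)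
    (hne : blockIter k (z.shift μ) ≠ x) : blockIter k ((z.shift κ).shift μ) ≠ x := by
  have hk' : k ≤ P.m + P.K := Nat.le_of_succ_le hk
  have hμ := blockIter_shift_eq_of_layer hk' hz hne
  rw [BlockAveragingEMLProp2.shift_shift_comm z κ μ]
  rcases blockIter_shift_or k hk' (z.shift μ) κ with h | h
  · rw [h, hμ]; exact (ne_shift_self x μ).symm
  · rw [h, hμ]; exact shift_shift_ne_self hk x μ κ

/-- **… AND ENTERED ONLY THROUGH THE BLOCK BOUNDARY**: if `z ∈ B^k(x)` is NOT on the layer then neither is `z + e_κ` (`κ ≠ μ`).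
[cite: Balaban1987RG1, (0.3) p.252 (bookkeeping)] -/
theorem not_layer_shift (hk : k ≤ P.m + P.K) {x : Site P k} {μ κ : Fin P.d} (hκμ : κ ≠ μ) {z : Site P 0}
    (hlay : blockIter k (z.shift μ) = x) (hκ : blockIter k (z.shift κ) = x) : blockIter k ((z.shift κ).shift μ) = x := by
  rcases blockIter_shift_or k hk (z.shift κ) μ with h | h
  · rw [h, hκ]
  · exfalso
    -- `B^k(z + e_κ + e_μ) = x + e_μ`, but also `∈ {B^k(z + e_μ), B^k(z + e_μ) + e_κ} = {x, x + e_κ}`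
    rw [hκ] at h
    rw [BlockAveragingEMLProp2.shift_shift_comm z κ μ] at h
    rcases blockIter_shift_or k hk (z.shift μ) κ with h' | h'
    · rw [h', hlay] at h; exact ne_shift_self x μ h
    · rw [h', hlay, shift_eq_shift_iff] at h; exact hκμ h

/-- ★ **THE OUTWARD PERIMETER, COUNTED**: the sites `z` on the layer whose `κ`-neighbour `z + e_κ` is NOT on the layer number at most `(L^k)^{d−2}` (they are the
forward `κ`-edge). [cite: Balaban1987RG1, (0.3) p.252 (bookkeeping)] -/
theorem card_perimeter_out_le (hk : k + 1 ≤ P.m + P.K) (x : Site P k) {μ κ : Fin P.d} (hκ : κ ≠ μ) :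
    (univ.filter fun z : Site P 0 => (blockIter k z = x ∧ blockIter k (z.shift μ) ≠ x) ∧
      ¬ (blockIter k (z.shift κ) = x ∧ blockIter k ((z.shift κ).shift μ) ≠ x)).card ≤ (P.L ^ k) ^ (P.d - 2) := by
  classical
  refine (card_le_card ?_).trans (card_layer_shift_ne_le (Nat.le_of_succ_le hk) x hκ)
  intro z hz
  rw [mem_filter] at hz ⊢
  obtain ⟨-, ⟨hzx, hne⟩, hout⟩ := hz
  refine ⟨mem_univ _, hzx, hne, fun hκx => hout ⟨hκx, layer_shift hk κ hzx hne⟩⟩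

/-- ★ **THE INWARD PERIMETER, COUNTED**: the sites `z` NOT on the layer whose `κ`-neighbour `z + e_κ` IS on the layer number at most `(L^k)^{d−2}` (shifted by `e_κ`
they are the backward `κ`-edge). [cite: Balaban1987RG1, (0.3) p.252 (bookkeeping)] -/
theorem card_perimeter_in_le (hk : k + 1 ≤ P.m + P.K) (x : Site P k) {μ κ : Fin P.d} (hκ : κ ≠ μ) :
    (univ.filter fun z : Site P 0 => ¬ (blockIter k z = x ∧ blockIter k (z.shift μ) ≠ x) ∧
      (blockIter k (z.shift κ) = x ∧ blockIter k ((z.shift κ).shift μ) ≠ x)).card ≤ (P.L ^ k) ^ (P.d - 2) := by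
  classical
  have hk' : k ≤ P.m + P.K := Nat.le_of_succ_le hk
  -- shift by `e_κ` into the backward edge
  refine (Finset.card_le_card_of_injOn (fun z : Site P 0 => z.shift κ) (fun z hz => ?_) (fun z _ z' _ h => ?_)).trans
    (card_layer_unshift_ne_le hk' x hκ)
  · simp only [coe_filter, Set.mem_setOf_eq, mem_univ, true_and] at hz ⊢
    obtain ⟨hnot, hlay, hne⟩ := hz
    refine ⟨hlay, hne, ?_⟩
    rw [B10StarCount.unshift_shift]
    intro hzx
    -- then `z ∈ B^k(x)` is not on the layer, so `z + e_κ` is not either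
    have hzμ : blockIter k (z.shift μ) = x := by
      by_contra h; exact hnot ⟨hzx, h⟩
    exact hne (not_layer_shift hk' hκ hzμ hlay)
  · simpa using congrArg (fun t : Site P 0 => t.unshift κ) h

end Summit.QuantumFields.YangMills.Theorems.FluctuationComparisonRegPrIntLS2BetaFaceLayerCounts
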